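/-
Copyright (c) 2026. All rights reserved.
Released under Apache 2.0 license as described in the file LICENSE.
Authors: abc-iut cell, wave-5 prover seat abc-iut-w5-d009 (gen 4).
-/
import Literature.NumberTheory.DiophantineGeometry.GenEllThm21
import HarnessLib

/-!
# [GenEll] Thm. 2.1 (ii): monotonicity in the support `Σ`, and the `Σ ⊆ {2}` cases from the `{2}` case

Mochizuki, *Arithmetic elliptic curves in general position*, Math. J. Okayama Univ. 52 (2010)
(`MochizukiGenEll2010`), Theorem 2.1 p. 11: statement (ii) for a finite set of primes `Σ` says that
Vojta's inequality holds on every compactly bounded subset `K_V ⊆ U_P(Q̄)` WHOSE SUPPORT CONTAINS `Σ`.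

PROOF-ONLY file (pure logic over `GenEllThm21.lean`).  Two remarks used by the cell's fact bookkeeping
(plan/F-TRANCHES.tsv row F-1336 `GenEll_thm21_primes`):

* `abcCompactlyBounded_of_subset` — statement (ii) is MONOTONE along `⊆` in the support: if it holds
  for `Σ'` then it holds for every `Σ ⊇ Σ'` (fewer subsets qualify).  In particular (ii) for `Σ = ∅`
  is the strongest and (ii) for any `Σ ⊆ {2}` implies (ii) for `{2}`.
* `genEll_thm21_primes_of_subset_two` — hence the direction (ii) ⟹ (i) of Thm. 2.1 AT `Σ = {2}` (the
  route's support item `GenEllTwo`, `Summit.ABC.ABC.Theses.IUTThetaPilot.GenEllTwo`, whose proof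
  `genEllTwo_holds` is the cell's p422748) already yields (ii) ⟹ (i) for every `Σ ⊆ {2}`; only the
  prime sets `Σ ⊄ {2}` of `GenEll_thm21_primes` need the `p`-generic argument.  Stated here with the
  `{2}`-case as a HYPOTHESIS (this Literature file cannot import the Summits-side theorem).

Classical; no bearing on, and no side taken on, [IUTchIII] Cor. 3.12.
-/

namespace Literature.NumberTheory.DiophantineGeometry.GenEll

/-- **(ii) is monotone in the support**: (ii) for `Σ'` implies (ii) for every `Σ ⊇ Σ'` — a compactly
bounded subset whose support contains `Σ` has support containing `Σ'`.
[cite: MochizukiGenEll2010, Thm 2.1 (ii) p.11] -/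
theorem abcCompactlyBounded_of_subset {S' S : Finset ℕ} (hS : S' ⊆ S) (h : ABCCompactlyBounded S') :
    ABCCompactlyBounded S :=
  fun d hd ε hε D hD => h d hd ε hε D (hS.trans hD)

/-- (ii) for `Σ = ∅` (Vojta on every compactly bounded subset) implies (ii) for every `Σ`.
[cite: MochizukiGenEll2010, Thm 2.1 (ii) p.11] -/
theorem abcCompactlyBounded_of_empty (S : Finset ℕ) (h : ABCCompactlyBounded ∅) :
    ABCCompactlyBounded S :=
  abcCompactlyBounded_of_subset (Finset.empty_subset S) h

/-- **The `Σ ⊆ {2}` cases of (ii) ⟹ (i) from the `{2}` case**: if (ii) for `{2}` implies (i)|_{ℙ¹} in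
every degree (the cell's `GenEllTwo`), then so does (ii) for every `Σ ⊆ {2}` (i.e. `Σ = ∅` or `{2}`).
[cite: MochizukiGenEll2010, Thm 2.1 p.11] -/
theorem genEll_thm21_primes_of_subset_two
    (h2 : ABCCompactlyBounded {2} → ∀ d : ℕ, 0 < d → VojtaP1Deg d)
    (S : Finset ℕ) (hS : S ⊆ {2}) (h : ABCCompactlyBounded S) (d : ℕ) (hd : 0 < d) : VojtaP1Deg d :=
  h2 (abcCompactlyBounded_of_subset hS h) d hd

/-- Equivalent packaging: under the `{2}` case, `GenEll_thm21_primes` reduces to its prime sets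
`Σ ⊄ {2}`. [cite: MochizukiGenEll2010, Thm 2.1 p.11] -/
theorem genEll_thm21_primes_of_two_of_not_subset
    (h2 : ABCCompactlyBounded {2} → ∀ d : ℕ, 0 < d → VojtaP1Deg d)
    (hrest : ∀ S : Finset ℕ, (∀ p ∈ S, p.Prime) → ¬ S ⊆ {2} →
      ABCCompactlyBounded S → ∀ d : ℕ, 0 < d → VojtaP1Deg d) :
    GenEll_thm21_primes := by
  intro S hS h d hd
  by_cases hsub : S ⊆ {2}
  · exact genEll_thm21_primes_of_subset_two h2 S hsub h d hd
  · exact hrest S hS hsub h d hd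

end Literature.NumberTheory.DiophantineGeometry.GenEll
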